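import Literature.NumberTheory.Automorphic.LanglandsTetrahedral
import Literature.NumberTheory.GaloisRepresentations.FrobeniusDensityTheorem
import HarnessLib

/-!
# Langlands–Tunnell without Chebotarev: the Frobenius density theorem suffices

Topic `Literature/NumberTheory/Automorphic` (trunk AutomorphicL, targets lang.S23/S24/S30).
Everything in this file is PROVED (no `sorry`).

The two places where the Langlands–Tunnell files invoke Chebotarev's density theorem (the named
fact `Literature.NumberTheory.Automorphic.chebotarev_artinRep`, `TunnellLemma.lean`) only need a Frobenius element in the
*division* of a given element — a property stable under `x ↦ x^k`, `(k, ord x) = 1`: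

* Tunnell's Lemma (`tunnell_lemma_of_fibres`, Tunnell 1981 p. 174): a place `v` whose Frobenius is
  a `4`-cycle in `\bar σ(Γ_F) ≅ S_4`; the odd powers of a `4`-cycle are `4`-cycles.
* The non-monomiality of `π_ps(σ)` in Langlands' tetrahedral theorem
  (`not_isQuadraticSelfTwistAE_of_lift`, Gelbart 1997 p. 256): a place `v` inert in a quadratic
  `K` with `σ(Frob_v)` central; for `τ = σ ⊕ χ_{K/F}` and `g₀` with `σ(g₀)` central,
  `χ_{K/F}(g₀) = -1`, every `τ(g₀)^k` with `k` prime to the (even) order of `τ(g₀)` has the same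
  two properties.

Hence the PROVED Frobenius density theorem
(`Literature.NumberTheory.GaloisRepresentations.FramedGaloisRep.infinite_setOf_frobenius_mem_division`,
`GaloisRepresentations/FrobeniusDensityTheorem`,
Frobenius 1896) can replace Chebotarev (1922) in the Langlands–Tunnell assembly. This file carries
out the replacement, re-running the two proofs with the division-form input:

* `frobenius_artinRep` — the division form of `chebotarev_artinRep` for Artin representations,
  proved;
* `infinite_setOf_frob_pow_and_quadraticSign_eq_neg_one`, `not_isQuadraticSelfTwistAE_of_lift'`,
  `strongArtin_of_isTetrahedralType_of_adjoint_lift'` — Langlands' tetrahedral theorem from the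
  dihedral case, cubic descent, the Gelbart–Jacquet lift, `π(Ad σ)`, Jacquet–Shalika and the Satake
  facts only;
* `tunnell_lemma_of_fibres'` — Tunnell's Lemma from Arthur–Clozel III.3.1, the cuspidality of the
  cubic lifts and the Satake facts only;
* `langlands_tunnell_of_functoriality'` — `Literature.Lang.langlands_tunnell ρ` for every `ρ` from the
  functorial named facts (dihedral strong Artin, base change ×3, quadratic twist, Gelbart–Jacquet,
  `π(Ad σ)`, Jacquet–Shalika, cubic-lift cuspidality, Satake uniqueness/cofiniteness, Gelbart
  Props. 4.1/4.2) — **with no Chebotarev hypothesis**.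

The proofs are those of `TunnellLemma.lean` / `LanglandsTetrahedral.lean` (same author) with the
Chebotarev step replaced; the unprimed theorems are kept there unchanged.

## References

* J. Tunnell, *Artin's conjecture for representations of octahedral type*, Bull. AMS 5 (1981),
  Lemma p. 174. [Tunnell1981]
* S. Gelbart, *Three lectures on the modularity of `\bar ρ_{E,3}` and the Langlands reciprocity
  conjecture*, in Cornell–Silverman–Stevens (1997), §7.1 (b) p. 256, §7.2 p. 259. [Gelbart1997]
* G. Frobenius, S.-B. Preuss. Akad. Wiss. Berlin (1896), 689–703 (density of divisions). [folklore]
-/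

noncomputable section

open scoped MatrixGroups NumberField Polynomial Classical
open NumberField IsDedekindDomain Field Polynomial Literature.NumberTheory.Automorphic Filter

namespace Literature.NumberTheory.Automorphic

/-! ### Frobenius' theorem for Artin representations (the division form of `chebotarev_artinRep`) -/

section ArtinFrobenius

/-- **Frobenius' density theorem for Artin representations, division form — PROVED.** For an
Artin representation `σ : Γ_F → GL_n(ℂ)` (continuous, hence of finite image,
`finite_range_toMonoidHom`, hence with open kernel) and `g ∈ Γ_F` there are infinitely many
finite places `v` of `F` at which `σ` is unramified and which admit an arithmetic Frobenius `φ`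
with `σ(φ) = σ(g)^k` for some `k` prime to the order of `σ(g)`. This is the named fact
`chebotarev_artinRep` (`TunnellLemma`) with the conjugacy class of `σ(g)` weakened to its
division — which is all the Langlands–Tunnell files use — and it is a theorem
(`Literature.NumberTheory.GaloisRepresentations.FramedGaloisRep.infinite_setOf_frobenius_mem_division`). [cite: Marcus2018, Ch. 7, Exercise 12 (f)] -/
theorem frobenius_artinRep (F : Type) [Field F] [NumberField F] (n : ℕ) (σ : GaloisRepresentations.FramedArtinRep F n)
    (g : absoluteGaloisGroup F) :
    {v : HeightOneSpectrum (𝓞 F) | σ.IsUnramifiedAt v ∧ ∃ 𝔓 ∈ v.primesAbove,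
      ∃ φ : absoluteGaloisGroup F, IsArithFrobAt (𝓞 F) φ 𝔓 ∧
        ∃ k : ℕ, k.Coprime (orderOf (σ g)) ∧ σ φ = σ g ^ k}.Infinite :=
  haveI : Finite σ.toMonoidHom.range := finite_range_toMonoidHom σ
  σ.infinite_setOf_frobenius_mem_division (GaloisRepresentations.isOpen_ker_of_finite_range σ) g

end ArtinFrobenius

/-! ### Frobenius' theorem for `σ ⊕ χ_{K/F}` -/

section InertFrobenius

variable {F : Type} [Field F] [NumberField F] (K : Type) [Field K] [NumberField K] [Algebra F K]

/-- **Infinitely many places, inert in `K`, with Frobenius in the division of `g₀` under `σ`**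
(Frobenius' theorem, `Literature.NumberTheory.GaloisRepresentations.FramedGaloisRep.infinite_setOf_frobenius_mem_division`, for
`σ ⊕ χ_{K/F}`; the Chebotarev-free form of `infinite_setOf_frob_eq_and_quadraticSign_eq_neg_one`).
Let `σ : Γ_F → GL_2(ℂ)` be an Artin representation, `K/F` quadratic and `g₀ ∈ Γ_F ∖ Gal(F̄/K)`.
Then there are infinitely many finite places `v` of `F`, unramified for `σ`, inert in `K`
(`ε_{K/F}(v) = -1`), admitting an arithmetic Frobenius `φ` with `σ(φ) = σ(g₀)^k` for some `k`:
Frobenius' theorem for `τ = σ ⊕ χ_{K/F}` and `g₀` gives `τ(φ) = τ(g₀)^k` with `k` prime to the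
order of `τ(g₀)`, which is even (or infinite) because `χ_{K/F}(g₀) = -1`; so `k` is odd and
`χ_{K/F}(φ) = (-1)^k = -1`. [folklore] -/
theorem infinite_setOf_frob_pow_and_quadraticSign_eq_neg_one
    (σ : GaloisRepresentations.FramedArtinRep F 2) (h2 : Module.finrank F K = 2) {g₀ : absoluteGaloisGroup F}
    (hg₀ : g₀ ∉ ((GaloisRepresentations.absGaloisRestrict F K).range : Subgroup (absoluteGaloisGroup F))) :
    {v : HeightOneSpectrum (𝓞 F) | σ.IsUnramifiedAt v ∧ quadraticSign K v = -1 ∧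
      ∃ 𝔓 ∈ v.primesAbove, ∃ φ : absoluteGaloisGroup F,
        IsArithFrobAt (𝓞 F) φ 𝔓 ∧ ∃ k : ℕ, σ φ = σ g₀ ^ k}.Infinite := by
  classical
  haveI : FiniteDimensional F K := Module.finite_of_finrank_eq_succ h2
  obtain ⟨hopen, hindex⟩ := isOpen_range_absGaloisRestrict_and_index F K
  rw [h2] at hindex
  -- the Artin representation `σ ⊕ χ`
  haveI : Finite σ.toMonoidHom.range := finite_range_toMonoidHom σ
  have hker : IsOpen ((blockSum σ.toMonoidHom (signCharOfIndexTwo (R := ℂ) _ hindex)).ker :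
      Set (absoluteGaloisGroup F)) := by
    rw [ker_blockSum, ker_signCharOfIndexTwo]
    exact (GaloisRepresentations.isOpen_ker_of_finite_range σ).inter hopen
  let τ : GaloisRepresentations.FramedArtinRep F 3 :=
    { blockSum σ.toMonoidHom (signCharOfIndexTwo (R := ℂ) _ hindex) with
      continuous_toFun := MonoidHom.continuous_of_isOpen_ker _ hker }
  have hτ : ∀ g, τ g = blockSum σ.toMonoidHom (signCharOfIndexTwo (R := ℂ) _ hindex) g :=
    fun _ => rfl
  have hχg₀ : signCharOfIndexTwo (R := ℂ) _ hindex g₀ = -1 :=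
    signCharOfIndexTwo_apply_of_not_mem hindex hg₀
  refine (τ.infinite_setOf_frobenius_mem_division hker g₀).mono ?_
  rintro v ⟨hunr, 𝔓, h𝔓, φ, hφ, k, hk, hval⟩
  -- `k` is odd: `χ(g₀) = -1` forces the order of `τ(g₀)` to be even (or infinite)
  have hkodd : Odd k := by
    set m := orderOf (τ g₀) with hm
    rcases Nat.eq_zero_or_pos m with h0 | hpos
    · rw [h0, Nat.coprime_zero_right] at hk
      rw [hk]
      exact odd_one
    · have h1 : τ (g₀ ^ m) = τ 1 := by rw [map_pow, map_one, hm, pow_orderOf_eq_one]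
      rw [hτ, hτ, blockSum_apply_eq_iff] at h1
      obtain ⟨-, h1⟩ := h1
      rw [map_pow, map_one, hχg₀] at h1
      have hne : (-1 : ℂˣ) ≠ 1 := fun h => by
        have h' := Units.ext_iff.mp h
        norm_num at h'
      have heven : Even m := (neg_one_pow_eq_one_iff_even hne).mp h1
      by_contra hko
      rw [Nat.not_odd_iff_even] at hko
      have h2 : 2 ∣ Nat.gcd k m :=
        Nat.dvd_gcd (even_iff_two_dvd.mp hko) (even_iff_two_dvd.mp heven)
      rw [Nat.Coprime.gcd_eq_one hk] at h2
      exact absurd h2 (by norm_num)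
  rw [← map_pow, hτ, hτ, blockSum_apply_eq_iff] at hval
  have hunr' : ∀ 𝔓 ∈ v.primesAbove, ∀ γ ∈ 𝔓.inertia (absoluteGaloisGroup F),
      σ γ = 1 ∧ signCharOfIndexTwo (R := ℂ) _ hindex γ = 1 := by
    intro 𝔓 h𝔓 γ hγ
    have h := hunr 𝔓 h𝔓 γ hγ
    rw [hτ, ← (blockSum σ.toMonoidHom (signCharOfIndexTwo (R := ℂ) _ hindex)).map_one,
      blockSum_apply_eq_iff, map_one, map_one] at h
    exact h
  refine ⟨fun 𝔓 h𝔓 γ hγ => (hunr' 𝔓 h𝔓 γ hγ).1, ?_, 𝔓, h𝔓, φ, hφ, k, by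
    have h := hval.1
    change σ φ = σ (g₀ ^ k) at h
    rw [h, map_pow]⟩
  refine quadraticSign_eq_neg_one_of_signChar K hindex (fun 𝔓 h𝔓 γ hγ => (hunr' 𝔓 h𝔓 γ hγ).2)
    h𝔓 hφ ?_
  rw [hval.2, map_pow, hχg₀, hkodd.neg_one_pow]


end InertFrobenius

/-! ### Non-monomiality of `π_ps(σ)` and the tetrahedral case, without Chebotarev -/

section TetrahedralFrobenius

variable {F : Type} [Field F] [NumberField F]

/-- **`π_ps(σ)` is not monomial** (Gelbart 1997, §7.1 (b), N.B. on p. 256), in the unramified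
form needed for `GelbartJacquet_adjoint_lift`: if `π` lifts weakly to `π(σ_E)` (`E/F` cubic,
`σ` tetrahedral) then for no quadratic `K/F` is `t_{π,v} = ε_{K/F}(v) t_{π,v}` for almost all `v`.
Proof: pick `g₀ ∈ Γ_F` with `σ(g₀)` scalar and `g₀ ∉ Gal(F̄/K)`
(`exists_center_not_mem_range_of_isTetrahedralType`); by Frobenius' theorem for `σ ⊕ χ_{K/F}`
(`infinite_setOf_frob_pow_and_quadraticSign_eq_neg_one`) there are infinitely many `v`, inert in
`K`, with `σ(Frob_v) = σ(g₀)^k` scalar, i.e. Frobenius eigenvalues `{u, u}`; at such a (good) `v`,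
`t_{π,v} = {x, y}` has `x^f = y^f = u^f` for a place `w ∣ v` of `E` of odd degree `f ∈ {1, 3}`,
which is incompatible with `{-x, -y} = {x, y}`. (Chebotarev-free form of
`not_isQuadraticSelfTwistAE_of_lift`.) [folklore] -/
theorem not_isQuadraticSelfTwistAE_of_lift' (σ : GaloisRepresentations.FramedArtinRep F 2)
    (ht : GaloisRepresentations.IsTetrahedralType σ.toMonoidHom)
    {E : Type} [Field E] [NumberField E] [Algebra F E] (hdegE : Module.finrank F E = 3)
    {hF : isCompact_glFiniteIntegralLevel 2 F} {hE : isCompact_glFiniteIntegralLevel 2 E}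
    {PE : AutomorphicRepData (AutomorphyDatum.gl 2 E hE)}
    (hPE : IsPiOfArtinRep (σ.restrictField E) PE)
    {π : AutomorphicRepData (AutomorphyDatum.gl 2 F hF)} (hlift : IsWeakBaseChangeLiftAE π PE)
    (hSUE : PE.hasSatakeParamAt_unique) (hSC : π.hasSatakeParamAt_cofinite)
    (K : Type) [Field K] [NumberField K] [Algebra F K] (hK : Module.finrank F K = 2) :
    ¬ IsQuadraticSelfTwistAE K π := by
  intro hself
  obtain ⟨g₀, hg₀c, hg₀K⟩ := exists_center_not_mem_range_of_isTetrahedralType K σ ht hK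
  have hS := infinite_setOf_frob_pow_and_quadraticSign_eq_neg_one K σ hK hg₀K
  -- a good place in the infinite Frobenius set
  have G3 := eventually_forall_under_eq (F := F) (hPE.and hlift)
  have hT := (hself.and hSC).and G3
  rw [Filter.eventually_cofinite] at hT
  obtain ⟨v, ⟨hvunr, hε, 𝔓, h𝔓, φ, hφ, k, hφg⟩, hvT⟩ := (hS.sdiff hT).nonempty
  simp only [Set.mem_setOf_eq, not_not] at hvT
  obtain ⟨⟨hselfv, ⟨α, hα⟩⟩, hv3⟩ := hvT
  -- the Frobenius eigenvalues at `v` are `{u, u}`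
  obtain ⟨φ₁, β, hβ, -, hPv⟩ := exists_frobenius_satakePolynomial σ hvunr
  have hchφ : ((σ φ : GL (Fin 2) ℂ) : Matrix (Fin 2) (Fin 2) ℂ).charpoly = satakePolynomial β :=
    hPv 𝔓 h𝔓 φ hφ
  have hcen : σ φ ∈ Subgroup.center (GL (Fin 2) ℂ) := by rw [hφg]; exact Subgroup.pow_mem _ hg₀c k
  obtain ⟨u, hu0, rfl⟩ := eq_pair_self_of_mem_center σ hcen hchφ
  -- a place `w ∣ v` of `E` of degree `f ∈ {1, 3}`; `α^f = {u^f, u^f}`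
  obtain ⟨w, hw, hf13⟩ := exists_place_inertiaDeg_eq_one_or_three hdegE v
  obtain ⟨⟨γ, hγ, -, hγP⟩, hwl⟩ := hv3 w hw
  have eγ := eq_map_pow_of_hasFrobCharpolyAt_restrictField σ hvunr hβ hPv hw hγP
  have hαf : α.map (· ^ w.asIdeal.inertiaDeg (𝓞 F)) =
      ({(u : ℂ), u} : Multiset ℂ).map (· ^ w.asIdeal.inertiaDeg (𝓞 F)) := by
    rw [← eγ]
    exact hSUE (hwl v α hw hα) hγ
  obtain ⟨x, y, rfl⟩ := Multiset.card_eq_two.mp hα.card_eq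
  simp only [Multiset.insert_eq_cons, Multiset.map_cons, Multiset.map_singleton] at hαf
  obtain ⟨hxf, hyf⟩ : x ^ w.asIdeal.inertiaDeg (𝓞 F) = u ^ w.asIdeal.inertiaDeg (𝓞 F) ∧
      y ^ w.asIdeal.inertiaDeg (𝓞 F) = u ^ w.asIdeal.inertiaDeg (𝓞 F) := by
    rcases pair_eq_pair_iff.mp hαf with ⟨h1, h2⟩ | ⟨h1, h2⟩ <;> exact ⟨h1, h2⟩
  -- the self-twist at `v`: `{-x, -y} = {x, y}`
  have hst := hselfv _ hα
  rw [hε] at hst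
  simp only [Multiset.insert_eq_cons, Multiset.map_cons, Multiset.map_singleton, neg_one_mul] at hst
  have hfodd : Odd (w.asIdeal.inertiaDeg (𝓞 F)) := by
    rcases hf13 with h | h <;> rw [h] <;> decide
  have huf : u ^ w.asIdeal.inertiaDeg (𝓞 F) ≠ 0 := pow_ne_zero _ hu0
  rcases pair_eq_pair_iff.mp hst with ⟨h1, -⟩ | ⟨h1, -⟩
  · -- `-x = x`: `x = 0`
    have hx0 : x = 0 := by linear_combination h1 / (-2)
    rw [hx0, zero_pow hfodd.pos.ne'] at hxf
    exact huf hxf.symm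
  · -- `-x = y`: `u^f = y^f = -x^f = -u^f`
    have h2 : y ^ w.asIdeal.inertiaDeg (𝓞 F) = -(x ^ w.asIdeal.inertiaDeg (𝓞 F)) := by
      rw [← h1]; exact hfodd.neg_pow x
    rw [hxf, hyf] at h2
    have h0 : u ^ w.asIdeal.inertiaDeg (𝓞 F) = 0 := by linear_combination h2 / 2
    exact huf h0

/-- **Langlands' tetrahedral theorem from its named ingredients, without Chebotarev** (the
Chebotarev-free form of `strongArtin_of_isTetrahedralType_of_adjoint_lift`: the non-monomiality
of `π_ps` comes from Frobenius' theorem, `not_isQuadraticSelfTwistAE_of_lift'`) (Langlands, *Base change for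
GL(2)* (1980), §3; Gelbart 1997, §7.1). The named fact `strongArtin_of_isTetrahedralType`
(`Automorphic/StrongArtinGL2`) follows from: the dihedral case (`strongArtin_of_isDihedralType`,
for `σ_E`), cubic descent with central character `det σ` (`exists_cuspidal_descent_det_cubic`),
the Gelbart–Jacquet adjoint lift (`GelbartJacquet_adjoint_lift`), the cuspidal `π(Ad σ)`
(`exists_cuspidal_ad_of_isTetrahedralType`), Jacquet–Shalika's rigidity
(`JacquetShalika_eq_of_rsData_eq`) and the Satake facts — by **Gelbart's proof** (pp. 254–257), all of whose remaining steps
are proved here: `E = F̄^{\bar σ⁻¹(D_2)}` is cubic Galois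
(`exists_intermediateField_isGalois_of_normal`); `σ_E` is dihedral of type `D_2`, irreducible, so
`π(σ_E)` exists and descends to `π = π_ps(σ)` with `ω_π = det σ`; `π` is not monomial
(`not_isQuadraticSelfTwistAE_of_lift'`), so `Π_1^* = Ad(π)` is cuspidal; at almost every `v`,
either `t_{π,v} = β_v` (the Frobenius eigenvalues) or `v` is inert with `t_{π,v}` the scalar
`{b²/a, b²/a}` (`tetrahedral_local_dichotomy`, using the splitting lemma); in both cases the local
Rankin–Selberg factors of `Π_1^* × Π̃_1` and `Π_1 × Π̃_1` agree ((7.1.5), `rsData_triple_one_eq`),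
so `Π_1^* ≅ Π_1` (Jacquet–Shalika), i.e. `Ad(t_{π,v}) = Ad(β_v)` a.e., which excludes the scalar
case (`adParams_pair_ne_of_ne`: "`A_4` has no elements of order `6`"). Hence `π = π(σ)`.
[cite: Gelbart1997, §7.1, pp. 254–257] [cite: LanglandsBaseChange1980, §3] -/
theorem strongArtin_of_isTetrahedralType_of_adjoint_lift'
    (hd : strongArtin_of_isDihedralType) (hdesc : exists_cuspidal_descent_det_cubic)
    (hGJ : GelbartJacquet_adjoint_lift) (hAd : exists_cuspidal_ad_of_isTetrahedralType)
    (hJS : JacquetShalika_eq_of_rsData_eq)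
    (hSU : ∀ {n : ℕ} {K : Type} [Field K] [NumberField K]
      {hc : isCompact_glFiniteIntegralLevel n K} (π : AutomorphicRepData (AutomorphyDatum.gl n K hc)),
        π.hasSatakeParamAt_unique)
    (hSC : ∀ {n : ℕ} {K : Type} [Field K] [NumberField K]
      {hc : isCompact_glFiniteIntegralLevel n K} (π : AutomorphicRepData (AutomorphyDatum.gl n K hc)),
        π.hasSatakeParamAt_cofinite) :
    strongArtin_of_isTetrahedralType := by
  intro F _ _ σ _ htet
  obtain ⟨e⟩ := htet
  haveI : Finite σ.toMonoidHom.range := finite_range_toMonoidHom σ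
  have hker : IsOpen (σ.toMonoidHom.ker : Set (absoluteGaloisGroup F)) :=
    GaloisRepresentations.isOpen_ker_of_finite_range σ
  have hunr : ∀ᶠ v in Filter.cofinite, σ.IsUnramifiedAt v :=
    σ.eventually_isUnramifiedAt_of_isOpen_ker hker
  -- `D₂ ◁ A₄` and the cubic Galois field `E`
  obtain ⟨Q, hQn, hQi, hQc, ⟨eQ⟩, hQmem⟩ := exists_subgroup_klein_of_mulEquiv_alternatingGroup e
  haveI := hQn
  obtain ⟨E, hfinE, hgalE, hdegE, ⟨eE⟩, hfixE⟩ :=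
    exists_intermediateField_isGalois_of_normal σ hker Q
  haveI := hfinE
  haveI := hgalE
  haveI : NumberField E := NumberField.of_module_finite F E
  rw [hQi] at hdegE
  -- `σ_E` is dihedral (`D₂`) and irreducible: `P_E = π(σ_E)` exists
  haveI : Finite (σ.restrictField E).toMonoidHom.range := finite_range_toMonoidHom _
  have hdih : GaloisRepresentations.IsDihedralType (σ.restrictField E).toMonoidHom := ⟨2, le_rfl, ⟨eE.trans eQ⟩⟩
  have hirrE : (σ.restrictField E).toGaloisRep.IsIrreducible :=
    (isIrreducible_toStdRepresentation_iff _).mp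
      (GaloisRepresentations.isIrreducible_of_not_isCyclicType _
        (not_isCyclicType_of_mulEquiv_dihedralGroup_two (eE.trans eQ)))
  obtain ⟨hE, PE, hPE⟩ := hd (σ.restrictField E) hirrE hdih
  have hF : isCompact_glFiniteIntegralLevel 2 F := isCompact_glFiniteIntegralLevel_holds 2 F
  have hF3 : isCompact_glFiniteIntegralLevel 3 F := isCompact_glFiniteIntegralLevel_holds 3 F
  have hcardE : Nat.card (GaloisRepresentations.projectiveImage (σ.restrictField E).toMonoidHom) = 4 := by
    rw [Nat.card_congr eE.toEquiv, hQc]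
  -- `π = π_ps(σ)`: descent with central character `det σ`
  obtain ⟨π, hlift, hdet⟩ := hdesc F E hdegE σ ⟨e⟩ hcardE hF hE PE hPE
  -- `π` is not monomial; the adjoint lift `Π₁* = Ad(π)` and `Π₁ = π(Ad σ)`
  have hnm : ∀ (K : Type) [Field K] [NumberField K] [Algebra F K], Module.finrank F K = 2 →
      ¬ IsQuadraticSelfTwistAE K π.1 := fun K _ _ _ hK =>
    not_isQuadraticSelfTwistAE_of_lift' σ ⟨e⟩ hdegE hPE hlift (hSU PE.1) (hSC π.1) K hK
  obtain ⟨Ps, hPs⟩ := hGJ F hF hF3 π hnm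
  obtain ⟨P1, hP1⟩ := hAd F σ ⟨e⟩ hF3
  -- the data at almost every place, with the local dichotomy
  have G3 := eventually_forall_under_eq (F := F) (hPE.and hlift)
  have hgood : ∀ᶠ v : HeightOneSpectrum (𝓞 F) in Filter.cofinite, ∃ α β : Multiset ℂ,
      π.1.HasSatakeParamAt v α ∧ σ.IsUnramifiedAt v ∧ σ.HasFrobCharpolyAt v (satakePolynomial β) ∧
      Ps.1.HasSatakeParamAt v (adParams α) ∧ P1.1.HasSatakeParamAt v (adParams β) ∧
      (α = β ∨ ∃ a b : ℂ, β = {a, b} ∧ a ≠ 0 ∧ b ≠ 0 ∧ a ≠ b ∧ a ^ 3 = b ^ 3 ∧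
        α = {b ^ 2 * a⁻¹, b ^ 2 * a⁻¹}) := by
    refine ((((hunr.and (hSC π.1)).and G3).and ((hdet.and hPs).and hP1))).mono ?_
    rintro v ⟨⟨⟨hv1, ⟨α, hα⟩⟩, hv3⟩, ⟨hdetv, hPsv⟩, ⟨α₁, β, hα₁, -, hPv, hα₁β⟩⟩
    obtain ⟨-, β', hβ', -, hPv'⟩ := exists_frobenius_satakePolynomial σ hv1
    have hββ' : β = β' := satakePolynomial_eq_of_hasFrobCharpolyAt σ hPv hPv'
    have hβ2 : Multiset.card β = 2 := by rw [hββ', hβ']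
    rw [hα₁β] at hα₁
    refine ⟨α, β, hα, hv1, hPv, hPsv α hα, hα₁, ?_⟩
    refine tetrahedral_local_dichotomy σ e hQmem E hfixE hdegE hβ2 hPv hα.card_eq ?_
      (hdetv α β hα hPv)
    intro w hw
    obtain ⟨⟨γ, hγ, -, hγP⟩, hwl⟩ := hv3 w hw
    have eγ := eq_map_pow_of_hasFrobCharpolyAt_restrictField σ hv1 hβ2 hPv hw hγP
    rw [← eγ]
    exact hSU PE.1 (hwl v α hw hα) hγ
  -- (7.1.5): the local Rankin–Selberg data of `Π₁* × Π̃₁` and `Π₁ × Π̃₁` agree a.e.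
  have h715 : ∀ᶠ v : HeightOneSpectrum (𝓞 F) in Filter.cofinite, ∀ α₁ αs : Multiset ℂ,
      P1.1.HasSatakeParamAt v α₁ → Ps.1.HasSatakeParamAt v αs → rsData αs α₁ = rsData α₁ α₁ := by
    refine hgood.mono ?_
    rintro v ⟨α, β, hα, hv1, hPv, hPsv, hP1v, hdich⟩ α₁ αs hα₁ hαs
    rw [hSU P1.1 hα₁ hP1v, hSU Ps.1 hαs hPsv]
    rcases hdich with rfl | ⟨a, b, rfl, ha, hb, hab, hab3, rfl⟩
    · rfl
    · have hc : b ^ 2 * a⁻¹ ≠ 0 := mul_ne_zero (pow_ne_zero 2 hb) (inv_ne_zero ha)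
      have hr3 : (a * b⁻¹) ^ 3 = 1 := by
        rw [mul_pow, hab3, ← mul_pow, mul_inv_cancel₀ hb, one_pow]
      have hba : b * a⁻¹ = (a * b⁻¹)⁻¹ := by rw [mul_inv_rev, inv_inv]
      rw [adParams_pair hc hc, mul_inv_cancel₀ hc, adParams_pair ha hb, hba]
      exact rsData_triple_one_eq hr3
  have hJSv := hJS 3 F hF3 P1 Ps h715
  -- conclusion: `t_{π,v} = β_v` almost everywhere
  refine ⟨hF, π, (hgood.and hJSv).mono ?_⟩
  rintro v ⟨⟨α, β, hα, hv1, hPv, hPsv, hP1v, hdich⟩, hJv⟩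
  have had : adParams α = adParams β := hJv _ _ hP1v hPsv
  rcases hdich with rfl | ⟨a, b, rfl, ha, hb, hab, hab3, rfl⟩
  · exact ⟨α, hα, hv1, hPv⟩
  · exact absurd had (adParams_pair_ne_of_ne ha hb
      (mul_ne_zero (pow_ne_zero 2 hb) (inv_ne_zero ha)) hab)

end TetrahedralFrobenius

/-! ### Tunnell's Lemma without Chebotarev -/

section TunnellFrobenius

/-- **Tunnell's Lemma from the fibres of quadratic base change, without Chebotarev**
(Chebotarev-free form of `tunnell_lemma_of_fibres`: the auxiliary place with `4`-cycle Frobenius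
is supplied by Frobenius' theorem, `Literature.NumberTheory.GaloisRepresentations.FramedGaloisRep.infinite_setOf_frobenius_mem_division`,
which gives a Frobenius in the *division* of a `4`-cycle — again a `4`-cycle)
(Tunnell 1981, proof of the Lemma, p. 174; Gelbart 1997, p. 259). The named fact `tunnell_lemma` (`TunnellOctahedralGlobal`)
follows from Arthur–Clozel's Thm. 3.1 over `K` (`ArthurClozel_fibres_quadratic`, applied with
the quadratic extension `M = EK` of `K`), the cuspidality of the cubic lifts `BC_{K/F}(π_i)`
(`tunnell_cuspidal_cubic_lifts`), Frobenius' theorem and the Satake facts. Proof: the compositum `M ⊇ E, K` (`exists_compositum`, `[M:K] = 2`); for `Q_i` the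
cuspidal lift of `π_i` to `K`, both `P_K = π(σ_K)` and `Q_i` have `t^{f(x|w)} = β_v^{f(x|v)}` at
almost all places `x` of `M` (`eventually_map_pow_eq_of_lifts`, transitivity through `E`), so by
Thm. 3.1 `t_{Q_i} = t_{P_K}` a.e. (and then `P_K` is a weak lift of `π_i`) or
`t_{Q_i} = ε_{M/K} t_{P_K}` a.e.; if the latter held for both `i`, then `t_{π_1,v}^f = t_{π_2,v}^f =
(ε_{E/F}(v) t_{π_1,v})^f` at a place `w ∣ v` of `K` of odd degree `f`; choosing `v` (Chebotarev)
with Frobenius a `4`-cycle in `S_4` — so `v` is inert in `E` (`quadraticSign_eq_neg_one_of_sign_frob`)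
and the Frobenius eigenvalues `a, b` have `b/a = ±i` (`pow_four_eq_and_sq_ne_of_orderOf_eq_four`)
— gives `{x^f, y^f} = {-x^f, -y^f}` and `{x², y²} = {a², -a²}` for `t_{π_1,v} = {x, y}`, which is
absurd (`false_of_sq_pair_of_neg_pow_pair`). [cite: Tunnell1981, Lemma (p. 174)] -/
theorem tunnell_lemma_of_fibres' (ha : ArthurClozel_fibres_quadratic)
    (hb : tunnell_cuspidal_cubic_lifts)
    (hSU : ∀ {n : ℕ} {L : Type} [Field L] [NumberField L]
      {hc : isCompact_glFiniteIntegralLevel n L} (π : AutomorphicRepData (AutomorphyDatum.gl n L hc)),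
        π.hasSatakeParamAt_unique)
    (hSC : ∀ {n : ℕ} {L : Type} [Field L] [NumberField L]
      {hc : isCompact_glFiniteIntegralLevel n L} (π : AutomorphicRepData (AutomorphyDatum.gl n L hc)),
        π.hasSatakeParamAt_cofinite) :
    tunnell_lemma := by
  intro F E K _ _ _ _ _ _ _ _ hdegE hdegK σ hoct hcardE hcardK hF hE hK PE PK hPE hPK π₁ π₂ hl₁ hl₂ htw
  classical
  obtain ⟨e⟩ := hoct
  haveI : Finite σ.toMonoidHom.range := finite_range_toMonoidHom σ
  have hunr : ∀ᶠ v in Filter.cofinite, σ.IsUnramifiedAt v :=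
    σ.eventually_isUnramifiedAt_of_isOpen_ker (GaloisRepresentations.isOpen_ker_of_finite_range σ)
  -- the cuspidal cubic lifts
  obtain ⟨Q₁, hQ₁⟩ := hb F E K hdegE hdegK σ ⟨e⟩ hcardE hcardK hF hE hK PE hPE π₁ hl₁
  obtain ⟨Q₂, hQ₂⟩ := hb F E K hdegE hdegK σ ⟨e⟩ hcardE hcardK hF hE hK PE hPE π₂ hl₂
  -- the compositum `M ⊇ E, K`, quadratic over `K`
  haveI : FiniteDimensional F E := Module.Finite.of_restrictScalars_finite ℚ F E
  haveI : FiniteDimensional F K := Module.Finite.of_restrictScalars_finite ℚ F K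
  obtain ⟨M, iE, iK, hfinM, hle, hdvE, hdvK⟩ := Literature.NumberTheory.Automorphic.exists_compositum F E K
  haveI := hfinM
  haveI : NumberField M := NumberField.of_module_finite F M
  letI : Algebra E M := iE.toRingHom.toAlgebra
  letI : Algebra K M := iK.toRingHom.toAlgebra
  haveI : IsScalarTower F E M := IsScalarTower.of_algebraMap_eq fun x => (iE.commutes x).symm
  haveI : IsScalarTower F K M := IsScalarTower.of_algebraMap_eq fun x => (iK.commutes x).symm
  have hdegM : Module.finrank F M = 6 := by
    rw [hdegE] at hdvE; rw [hdegK] at hdvK; rw [hdegE, hdegK] at hle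
    have h6 : 6 ∣ Module.finrank F M := Nat.Coprime.mul_dvd_of_dvd_of_dvd (by norm_num) hdvE hdvK
    have hpos : 0 < Module.finrank F M := Module.finrank_pos
    obtain ⟨c, hc⟩ := h6
    omega
  have hKM : Module.finrank K M = 2 := by
    have h := Module.finrank_mul_finrank F K M
    rw [hdegK, hdegM] at h
    omega
  -- Arthur–Clozel Thm. 3.1 over `K`
  have H₁ := eventually_map_pow_eq_of_lifts (M := M) σ hunr hPE hPK hl₁ hQ₁ (hSU PE.1) (hSU PK.1)
    (hSU Q₁.1) (hSC π₁.1)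
  have H₂ := eventually_map_pow_eq_of_lifts (M := M) σ hunr hPE hPK hl₂ hQ₂ (hSU PE.1) (hSU PK.1)
    (hSU Q₂.1) (hSC π₂.1)
  rcases ha 2 K M hKM hK PK Q₁ H₁ with h1 | h1
  · exact Or.inl (hQ₁.of_satake_agree h1 (hSU Q₁.1) (hSC PK.1))
  rcases ha 2 K M hKM hK PK Q₂ H₂ with h2 | h2
  · exact Or.inr (hQ₂.of_satake_agree h2 (hSU Q₂.1) (hSC PK.1))
  -- both lifts are the `ε_{M/K}`-twist of `P_K`: contradiction at a place with `4`-cycle Frobenius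
  exfalso
  -- an element `g` with `\bar σ(g)` a `4`-cycle
  obtain ⟨g, hg⟩ := (GaloisRepresentations.mem_projectiveImage).mp (e.symm (finRotate 4)).2
  have heg : e ⟨Matrix.ProjGenLinGroup.mk (σ g), GaloisRepresentations.mk_apply_mem_projectiveImage σ.toMonoidHom g⟩ =
      finRotate 4 := by
    have : (⟨Matrix.ProjGenLinGroup.mk (σ g), GaloisRepresentations.mk_apply_mem_projectiveImage σ.toMonoidHom g⟩ :
        GaloisRepresentations.projectiveImage σ.toMonoidHom) = e.symm (finRotate 4) := Subtype.ext hg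
    rw [this, e.apply_symm_apply]
  have hsign4 : Equiv.Perm.sign (finRotate 4) = -1 := by decide
  have hord4 : orderOf (finRotate 4 : Equiv.Perm (Fin 4)) = 4 := by
    rw [(isCycle_finRotate (n := 2)).orderOf, support_finRotate]
    rfl
  -- the good places
  have GK := eventually_forall_under_eq (F := F)
    ((h1.and h2).and ((hQ₁.and hQ₂).and ((hSC PK.1).and hPK)))
  have GE := eventually_forall_under_eq (F := F) (hPE.and hl₁)
  have G := ((hunr.and (hSC π₁.1)).and htw).and (GK.and GE)
  rw [Filter.eventually_cofinite] at G
  have hkerσ : IsOpen (σ.toMonoidHom.ker : Set (absoluteGaloisGroup F)) :=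
    GaloisRepresentations.isOpen_ker_of_finite_range σ
  obtain ⟨v, ⟨hvS, hvG⟩⟩ := ((σ.infinite_setOf_frobenius_mem_division hkerσ g).sdiff G).nonempty
  simp only [Set.mem_setOf_eq, not_not] at hvG
  obtain ⟨⟨⟨hv1, ⟨α₁, hα₁⟩⟩, htwv⟩, hvK, hvE⟩ := hvG
  obtain ⟨-, 𝔓, h𝔓, φ, hφ, k, hk, hφgk⟩ := hvS
  -- `\bar σ(g^k)` is again a `4`-cycle: `k` is odd since `4 ∣ ord σ(g)`
  set g' : absoluteGaloisGroup F := g ^ k with hg'def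
  have hφg : σ φ = σ g' := by rw [hφgk, hg'def, map_pow]
  have hmk4 : orderOf (Matrix.ProjGenLinGroup.mk (σ g)) = 4 := by
    have h1 : orderOf (⟨Matrix.ProjGenLinGroup.mk (σ g),
        GaloisRepresentations.mk_apply_mem_projectiveImage σ.toMonoidHom g⟩ : GaloisRepresentations.projectiveImage σ.toMonoidHom) = 4 := by
      rw [← orderOf_injective e.toMonoidHom e.injective, MulEquiv.coe_toMonoidHom, heg, hord4]
    rw [← h1]
    exact Subgroup.orderOf_coe (⟨Matrix.ProjGenLinGroup.mk (σ g),
        GaloisRepresentations.mk_apply_mem_projectiveImage σ.toMonoidHom g⟩ : GaloisRepresentations.projectiveImage σ.toMonoidHom)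
  have h4dvd : 4 ∣ orderOf (σ g) := by
    rw [← hmk4]
    exact orderOf_map_dvd _ (σ g)
  have hk4 : k.Coprime 4 := Nat.Coprime.coprime_dvd_right h4dvd hk
  have hkodd : Odd k := by
    by_contra hko
    rw [Nat.not_odd_iff_even] at hko
    have h2 : 2 ∣ Nat.gcd k 4 := Nat.dvd_gcd (even_iff_two_dvd.mp hko) (by norm_num)
    rw [Nat.Coprime.gcd_eq_one hk4] at h2
    exact absurd h2 (by norm_num)
  have hk0 : k ≠ 0 := by rintro rfl; exact (by decide : ¬ Odd 0) hkodd
  have heg' : e ⟨Matrix.ProjGenLinGroup.mk (σ g'), GaloisRepresentations.mk_apply_mem_projectiveImage σ.toMonoidHom g'⟩ =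
      finRotate 4 ^ k := by
    have : (⟨Matrix.ProjGenLinGroup.mk (σ g'), GaloisRepresentations.mk_apply_mem_projectiveImage σ.toMonoidHom g'⟩ :
        GaloisRepresentations.projectiveImage σ.toMonoidHom) =
        ⟨Matrix.ProjGenLinGroup.mk (σ g), GaloisRepresentations.mk_apply_mem_projectiveImage σ.toMonoidHom g⟩ ^ k := by
      have hmk : Matrix.ProjGenLinGroup.mk (σ g') = Matrix.ProjGenLinGroup.mk (σ g) ^ k := by
        rw [hg'def, map_pow, map_pow]
      exact Subtype.ext (by rw [SubgroupClass.coe_pow]; exact hmk)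
    rw [this, map_pow, heg]
  have hsign4' : Equiv.Perm.sign (finRotate 4 ^ k) = -1 := by
    rw [map_pow, hsign4, hkodd.neg_one_pow]
  have hord4' : orderOf ((finRotate 4 : Equiv.Perm (Fin 4)) ^ k) = 4 := by
    rw [orderOf_pow' _ hk0, hord4, Nat.Coprime.gcd_eq_one hk4.symm, Nat.div_one]
  -- Frobenius eigenvalues `β = {a, b}` at `v`; they are those of `σ g'`
  obtain ⟨φ₀, β, hβ, hch₀, hPv⟩ := exists_frobenius_satakePolynomial σ hv1
  have hchφ : GaloisRepresentations.FramedRep.charpoly σ φ = satakePolynomial β := hPv 𝔓 h𝔓 φ hφ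
  obtain ⟨a, b, rfl⟩ := Multiset.card_eq_two.mp hβ
  have hchg : ((σ g' : GL (Fin 2) ℂ) : Matrix (Fin 2) (Fin 2) ℂ).charpoly = satakePolynomial {a, b} := by
    rw [← hφg]; exact hchφ
  have ha0 : a ≠ 0 := ne_zero_of_isRoot_charpoly_coe_generalLinearGroup (σ g')
    (hchg ▸ isRoot_satakePolynomial_pair_left a b)
  have hb0 : b ≠ 0 := ne_zero_of_isRoot_charpoly_coe_generalLinearGroup (σ g')
    (hchg ▸ isRoot_satakePolynomial_pair_right a b)
  obtain ⟨h4, h2⟩ := pow_four_eq_and_sq_ne_of_orderOf_eq_four σ e g' (by rw [heg', hord4']) hchg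
  -- `v` is inert in `E`
  have hεv : quadraticSign E v = -1 :=
    quadraticSign_eq_neg_one_of_sign_frob σ e hcardE hv1 h𝔓 hφ (by
      have : (⟨Matrix.ProjGenLinGroup.mk (σ φ), GaloisRepresentations.mk_apply_mem_projectiveImage σ.toMonoidHom φ⟩ :
          GaloisRepresentations.projectiveImage σ.toMonoidHom) =
          ⟨Matrix.ProjGenLinGroup.mk (σ g'), GaloisRepresentations.mk_apply_mem_projectiveImage σ.toMonoidHom g'⟩ :=
        Subtype.ext (show Matrix.ProjGenLinGroup.mk (σ φ) = Matrix.ProjGenLinGroup.mk (σ g') by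
          rw [hφg])
      rw [this, heg', hsign4'])
  -- `E`-side: `α₁² = {a², b²}`
  obtain ⟨u, hu⟩ := exists_above (E := E) v
  obtain ⟨hcE, hlE⟩ := hvE u hu
  have eE : α₁.map (· ^ u.asIdeal.inertiaDeg (𝓞 F)) = ({a, b} : Multiset ℂ).map (· ^ u.asIdeal.inertiaDeg (𝓞 F)) :=
    satakeParam_eq_frob_pow σ hv1 hβ hPv (hSU PE.1) hu hcE (hlE v α₁ hu hα₁)
  have hsq : α₁.map (· ^ 2) = ({a ^ 2, b ^ 2} : Multiset ℂ) := by
    rcases inertiaDeg_eq_one_or_two_of_finrank_eq_two hdegE v u hu with h | h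
    · rw [h] at eE
      simp only [pow_one, Multiset.map_id'] at eE
      rw [eE]; simp
    · rw [h] at eE
      rw [eE]; simp
  -- `K`-side at a place `w ∣ v` of odd degree `f`
  obtain ⟨w, hw, hf13⟩ := exists_place_inertiaDeg_eq_one_or_three hdegK v
  set f := w.asIdeal.inertiaDeg (𝓞 F) with hfdef
  have hfodd : Odd f := by rcases hf13 with h | h <;> rw [h] <;> decide
  obtain ⟨⟨hw1, hw2⟩, ⟨hwQ₁, hwQ₂⟩, ⟨γ, hγ⟩, -⟩ := hvK w hw
  have eQ₁ : α₁.map (· ^ f) = γ.map (quadraticSign M w * ·) :=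
    hSU Q₁.1 (hwQ₁ v α₁ hw hα₁) (hw1 γ hγ)
  have eQ₂ : (α₁.map (quadraticSign E v * ·)).map (· ^ f) = γ.map (quadraticSign M w * ·) :=
    hSU Q₂.1 (hwQ₂ v _ hw (htwv α₁ hα₁)) (hw2 γ hγ)
  have hneg : α₁.map (· ^ f) = (α₁.map (· ^ f)).map (fun t => -t) := by
    conv_lhs => rw [eQ₁, ← eQ₂]
    rw [hεv, Multiset.map_map, Multiset.map_map]
    refine Multiset.map_congr rfl fun t _ => ?_
    simp only [Function.comp_apply, neg_one_mul, hfodd.neg_pow]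
  -- conclude
  obtain ⟨x, y, rfl⟩ := Multiset.card_eq_two.mp hα₁.card_eq
  simp only [Multiset.map_cons, Multiset.map_singleton, Multiset.insert_eq_cons] at hsq hneg
  exact false_of_sq_pair_of_neg_pow_pair hfodd ha0 hb0 h4 h2 (by simpa using hsq) (by simpa using hneg)

end TunnellFrobenius

/-! ### Langlands–Tunnell from functoriality, without Chebotarev -/

section Assembly

/-- lang.S30 **from functoriality, without Chebotarev** (Langlands–Tunnell with the tetrahedral
and octahedral cases proved from their ingredients and the Chebotarev input replaced by the PROVED
Frobenius density theorem): `Literature.Lang.langlands_tunnell ρ` for every `ρ`, from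
the dihedral case of the strong Artin conjecture, Langlands' base change for `GL(2)` in the three
forms used (`cuspidal_descent_cyclic`, `exists_cuspidal_descent_det_cubic`,
`ArthurClozel_fibres_quadratic`), the quadratic twist, the Gelbart–Jacquet adjoint lift, the
cuspidal `π(Ad σ)`, Jacquet–Shalika's rigidity, the cuspidality of Tunnell's cubic lifts, the
Satake facts and Gelbart's Props. 4.1/4.2 — via `strongArtin_of_isTetrahedralType_of_adjoint_lift'`,
`tunnell_lemma_of_fibres'` (this file) and `langlands_tunnell_of_baseChange`
(`TunnellOctahedralGlobal`).
[cite: Gelbart1997, §7.1–7.2, pp. 254–259] -/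
theorem langlands_tunnell_of_functoriality'
    (hd : strongArtin_of_isDihedralType) (hdesc3 : exists_cuspidal_descent_det_cubic)
    (hGJ : GelbartJacquet_adjoint_lift) (hAd : exists_cuspidal_ad_of_isTetrahedralType)
    (hJS : JacquetShalika_eq_of_rsData_eq) (hdesc : cuspidal_descent_cyclic)
    (htw : exists_twist_quadraticSign) (ha : ArthurClozel_fibres_quadratic)
    (hb : tunnell_cuspidal_cubic_lifts)
    (hSU : ∀ {n : ℕ} {K : Type} [Field K] [NumberField K]
      {hc : isCompact_glFiniteIntegralLevel n K} (π : AutomorphicRepData (AutomorphyDatum.gl n K hc)),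
        π.hasSatakeParamAt_unique)
    (hSC : ∀ {n : ℕ} {K : Type} [Field K] [NumberField K]
      {hc : isCompact_glFiniteIntegralLevel n K} (π : AutomorphicRepData (AutomorphyDatum.gl n K hc)),
        π.hasSatakeParamAt_cofinite)
    (hAE : frobSatakeCompatibleAt_of_isPiOfArtinRep) (hW1 : exists_isNewform1_of_isPiOfArtinRep)
    (ρ : GaloisRepresentations.FramedArtinRep ℚ 2) : langlands_tunnell ρ :=
  langlands_tunnell_of_baseChange hd
    (strongArtin_of_isTetrahedralType_of_adjoint_lift' hd hdesc3 hGJ hAd hJS hSU hSC) hdesc htw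
    (tunnell_lemma_of_fibres' ha hb hSU hSC) hSU hSC hAE hW1 ρ

end Assembly

end Literature.NumberTheory.Automorphic
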